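import Summits.ResolutionOfSingularities.ResolutionOfSingularities.Theorems.EquisingularLiftEquisingularLiftNatFanGameOneWall
import HarnessLib

/-!
# [OURS · L1 W4.5(b) · EL♮(3) · D-0157 DOOR 1, WIDTH row iso-w4] FAN-GAME WINNABILITY — brick 1b: the ONE-WALL ENGINE and the
# two-element (binomial) tables

res-L1-w45b-iso-w4 g0 (prover, width seat; desk WIDTH TABLE D1/D1′ STATUS l.81504 / l.81520; referee crit-2).
`--kind proof --supports stmt-ResolutionOfSingularities-20148 --as helper`. Def-free, sorry-free, fact-free. OURS; counted 0; AI kernel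
work, weaker than expert review; NOT a statement of any manuscript; nothing of [Hironaka2017] is used; resolution of singularities in
characteristic `p` is NOT proved here or anywhere in this chain.

## What is proved

* `FanGame.reach_signConstant` — THE ONE-WALL ENGINE (any `n`; any table `V`; any position all of whose cones have `≤ 3` rays): if every
  cone on which the linear form `⟨·, z⟩` takes both signs is `Bad` for `V` (so that starring such a pair is E1-LEGAL), some E1-legal
  continuation `Reach V F F'` reaches a position on every cone of which `⟨·, z⟩` has constant sign.  Schedule: star the crossing pair
  maximising `ℓ p − ℓ q` over the whole position (`…NatFanGameOneWall` for the measure); induction on the measure.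
* `FanGame.card_le_of_reach`, `card_le_three_of_reach_orthant` — a star replaces one ray by the new one, so positions of the local game in
  dimension `n ≤ 3` have cones of at most three rays; `FanGame.reach_trans`.
* THE BINOMIAL COROLLARY `FanGame.reach_won_pair` / `fanGameWinnable_pair`: every two-element table `{a, b}` (the monomial ideal
  `(xᵃ, xᵇ)`) is winnable from every position reachable from `orthantFan n`, `n ≤ 3` — for such tables `Bad τ` IS «`⟨·,a⟩ − ⟨·,b⟩` takes
  both signs on `τ`» (`bad_pair_of_crossing`, `not_bad_pair_of_not_crossing`).

NOT proved here (honest gap, memo `L/res-L1-w45b-iso-w4/FANGAME-MEMO.md`): the full convenient-table theorem at `n = 3` (the row's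
target, which would re-cut the iso residue by `¬IsoHypNDWon → ¬IsoHypND`); the induction on `|V|` through the engine is `V'`-legal for
`V' ⊊ V` but can be `V`-illegal exactly on faces lying inside the domain of a vertex added later.
-/

set_option linter.dupNamespace false

namespace Summit.ResolutionOfSingularities.ResolutionOfSingularities.Cruxes.EquisingularLiftNat.Sections

namespace FanGame

variable {n : ℕ}

/-! ### Invariants along `Reach` -/

/-- Transitivity of `Reach`. -/
theorem reach_trans (V : Finset (Fin n → ℕ)) {G K : Finset (Finset (Ray n))} (h₂ : Reach V G K) :
    ∀ {F : Finset (Finset (Ray n))}, Reach V F G → Reach V F K := by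
  induction h₂ with
  | refl => exact fun h₁ => h₁
  | step K₁ τ σ _ hσ hτσ hne hB ih => exact fun h₁ => Reach.step _ _ τ σ (ih h₁) hσ hτσ hne hB

/-- A bound on the number of rays of every cone is preserved along `Reach` (a star replaces one ray by the new one). -/
theorem card_le_of_reach (V : Finset (Fin n → ℕ)) {F₀ F : Finset (Finset (Ray n))} (h : Reach V F₀ F) {c : ℕ}
    (h₀ : ∀ σ ∈ F₀, σ.card ≤ c) : ∀ σ ∈ F, σ.card ≤ c := by
  classical
  induction h with
  | refl => exact h₀
  | step F₂ τ σ _ hσ hτσ hne hBad ih =>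
    intro γ hγ
    simp only [star, Finset.mem_union, Finset.mem_filter, Finset.mem_biUnion, Finset.mem_image] at hγ
    rcases hγ with ⟨hγF, -⟩ | ⟨σ₁, ⟨hσ₁F, hτσ₁⟩, t, ht, rfl⟩
    · exact ih γ hγF
    · have htσ₁ : t ∈ σ₁ := hτσ₁ ht
      calc (insert (∑ ρ ∈ τ, ρ) (σ₁.erase t)).card ≤ (σ₁.erase t).card + 1 := Finset.card_insert_le _ _
        _ = σ₁.card := by rw [Finset.card_erase_of_mem htσ₁]; exact Nat.sub_add_cancel (Finset.card_pos.2 ⟨t, htσ₁⟩)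
        _ ≤ c := ih σ₁ hσ₁F

/-- The cones of a position of the local game in dimension `n ≤ 3` have at most three rays. -/
theorem card_le_three_of_reach_orthant (hn : n ≤ 3) (V : Finset (Fin n → ℕ)) {F : Finset (Finset (Ray n))}
    (h : Reach V (orthantFan n) F) : ∀ σ ∈ F, σ.card ≤ 3 :=
  card_le_of_reach V h (fun σ hσ => by
    rw [orthantFan, Finset.mem_singleton] at hσ
    subst hσ
    exact Finset.card_image_le.trans (by simpa using hn))

/-! ### The one-wall engine -/

/-- **THE ONE-WALL ENGINE.**  `V` any table, `z` any integer vector such that every cone on which `⟨·, z⟩` takes both signs is `Bad`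
for `V` (so that starring such a pair is E1-LEGAL), `F` any position all of whose cones have at most three rays.  Then some E1-legal
continuation `Reach V F F'` reaches a position on every cone of which `⟨·, z⟩` has constant sign (and whose cones still have at most
three rays).  Strategy and measure: see the module docstring. [OURS · L1 W4.5b · D-0157 DOOR 1 row iso-w4, brick 1] -/
theorem reach_signConstant (V : Finset (Fin n → ℕ)) (z : Fin n → ℤ) (hBad : ∀ τ : Finset (Ray n), Crossing z τ → Bad V τ) :
    ∀ F : Finset (Finset (Ray n)), (∀ σ ∈ F, σ.card ≤ 3) →
      ∃ F', Reach V F F' ∧ (∀ σ ∈ F', σ.card ≤ 3) ∧ ∀ σ ∈ F', ¬ Crossing z σ := by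
  classical
  suffices H : ∀ (m : ℕ) (F : Finset (Finset (Ray n))), measure z F ≤ m → (∀ σ ∈ F, σ.card ≤ 3) →
      ∃ F', Reach V F F' ∧ (∀ σ ∈ F', σ.card ≤ 3) ∧ ∀ σ ∈ F', ¬ Crossing z σ from
    fun F hF => H _ F le_rfl hF
  intro m
  induction m with
  | zero =>
    intro F hm hF
    refine ⟨F, Reach.refl F, hF, fun σ hσ hC => ?_⟩
    have h1 : weight z σ ≤ measure z F := Finset.single_le_sum (f := weight z) (fun _ _ => Nat.zero_le _) hσ
    have h2 : weight z σ = 3 ^ (posSum z σ * negSum z σ) := if_pos hC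
    have h3 : 0 < 3 ^ (posSum z σ * negSum z σ) := pow_pos (by norm_num) _
    omega
  | succ m ih =>
    intro F hm hF
    by_cases hex : ∃ σ ∈ F, Crossing z σ
    · -- choose the crossing pair maximising `ℓ p - ℓ q` over the whole position
      let S : Finset (Ray n × Ray n) :=
        F.biUnion (fun σ => (σ ×ˢ σ).filter (fun pq => 0 < lin z pq.1 ∧ lin z pq.2 < 0))
      have hSmem : ∀ pq : Ray n × Ray n, pq ∈ S ↔ ∃ σ ∈ F, pq.1 ∈ σ ∧ pq.2 ∈ σ ∧ 0 < lin z pq.1 ∧ lin z pq.2 < 0 := by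
        intro pq
        simp only [S, Finset.mem_biUnion, Finset.mem_filter, Finset.mem_product]
        constructor
        · rintro ⟨σ, hσ, ⟨h1, h2⟩, h3, h4⟩; exact ⟨σ, hσ, h1, h2, h3, h4⟩
        · rintro ⟨σ, hσ, h1, h2, h3, h4⟩; exact ⟨σ, hσ, ⟨h1, h2⟩, h3, h4⟩
      have hSne : S.Nonempty := by
        obtain ⟨σ, hσ, ⟨p, hp, hp0⟩, ⟨q, hq, hq0⟩⟩ := hex
        exact ⟨(p, q), (hSmem (p, q)).2 ⟨σ, hσ, hp, hq, hp0, hq0⟩⟩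
      obtain ⟨⟨p, q⟩, hpqS, hmaxS⟩ := S.exists_max_image (fun pq => lin z pq.1 - lin z pq.2) hSne
      obtain ⟨σ₀, hσ₀, hp, hq, hp0, hq0⟩ := (hSmem (p, q)).1 hpqS
      have hext : ∀ σ ∈ F, p ∈ σ → q ∈ σ → (∀ ρ ∈ σ, lin z ρ ≤ lin z p) ∧ (∀ ρ ∈ σ, lin z q ≤ lin z ρ) := by
        intro σ hσ hpσ hqσ
        refine ⟨fun ρ hρ => ?_, fun ρ hρ => ?_⟩
        · by_cases h : 0 < lin z ρ
          · have := hmaxS (ρ, q) ((hSmem (ρ, q)).2 ⟨σ, hσ, hρ, hqσ, h, hq0⟩)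
            dsimp only at this; linarith
          · linarith
        · by_cases h : lin z ρ < 0
          · have := hmaxS (p, ρ) ((hSmem (p, ρ)).2 ⟨σ, hσ, hpσ, hρ, hp0, h⟩)
            dsimp only at this; linarith
          · linarith
      -- the star
      have hpq : p ≠ q := by rintro rfl; exact lt_irrefl _ (hq0.trans hp0)
      have hτσ₀ : ({p, q} : Finset (Ray n)) ⊆ σ₀ := by
        rw [Finset.insert_subset_iff, Finset.singleton_subset_iff]; exact ⟨hp, hq⟩
      have hτne : ({p, q} : Finset (Ray n)).Nonempty := ⟨p, Finset.mem_insert_self _ _⟩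
      have hτbad : Bad V ({p, q} : Finset (Ray n)) :=
        hBad _ ⟨⟨p, Finset.mem_insert_self _ _, hp0⟩, ⟨q, Finset.mem_insert_of_mem (Finset.mem_singleton_self _), hq0⟩⟩
      have hR₁ : Reach V F (star F {p, q}) := Reach.step F F {p, q} σ₀ (Reach.refl F) hσ₀ hτσ₀ hτne hτbad
      have hF₁ : ∀ σ ∈ star F ({p, q} : Finset (Ray n)), σ.card ≤ 3 := card_le_of_reach V hR₁ hF
      have hlt : measure z (star F ({p, q} : Finset (Ray n))) < measure z F := measure_star_lt z hF hp0 hq0 hext hσ₀ hp hq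
      obtain ⟨F', hR', hF', hW'⟩ := ih (star F {p, q}) (by omega) hF₁
      exact ⟨F', reach_trans V hR' hR₁, hF', hW'⟩
    · exact ⟨F, Reach.refl F, hF, fun σ hσ hC => hex ⟨σ, hσ, hC⟩⟩

/-! ### The binomial corollary: two-element tables are winnable -/

/-- For the table `{a, b}`, a cone on which `⟨·, a⟩ - ⟨·, b⟩` takes both signs is `Bad`. -/
theorem bad_pair_of_crossing (a b : Fin n → ℕ) {τ : Finset (Ray n)}
    (h : Crossing (fun i => (a i : ℤ) - b i) τ) : Bad ({a, b} : Finset (Fin n → ℕ)) τ := by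
  have hlin : ∀ ρ : Ray n, lin (fun i => (a i : ℤ) - b i) ρ = pair ρ a - pair ρ b := fun ρ => by
    simp only [lin, pair, mul_sub, Finset.sum_sub_distrib]
  obtain ⟨⟨p, hp, hp0⟩, ⟨q, hq, hq0⟩⟩ := h
  rw [hlin] at hp0 hq0
  rintro ⟨m, hm, hmin⟩
  simp only [Finset.mem_insert, Finset.mem_singleton] at hm
  rcases hm with rfl | rfl
  · have := hmin p hp b (by simp); linarith
  · have := hmin q hq a (by simp); linarith

/-- For the table `{a, b}`, a cone on which `⟨·, a⟩ - ⟨·, b⟩` has constant sign is not `Bad`. -/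
theorem not_bad_pair_of_not_crossing (a b : Fin n → ℕ) {σ : Finset (Ray n)}
    (h : ¬ Crossing (fun i => (a i : ℤ) - b i) σ) : ¬ Bad ({a, b} : Finset (Fin n → ℕ)) σ := by
  have hlin : ∀ ρ : Ray n, lin (fun i => (a i : ℤ) - b i) ρ = pair ρ a - pair ρ b := fun ρ => by
    simp only [lin, pair, mul_sub, Finset.sum_sub_distrib]
  intro hB; apply hB
  rcases not_and_or.1 h with h | h
  · -- no ray with `⟨ρ, a⟩ > ⟨ρ, b⟩`: `a` is a common minimiser
    have h' : ∀ ρ ∈ σ, pair ρ a ≤ pair ρ b := fun ρ hρ => by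
      have := not_lt.1 (fun hlt => h ⟨ρ, hρ, hlt⟩); rw [hlin] at this; linarith
    refine ⟨a, by simp, fun ρ hρ m' hm' => ?_⟩
    simp only [Finset.mem_insert, Finset.mem_singleton] at hm'
    rcases hm' with rfl | rfl
    · exact le_rfl
    · exact h' ρ hρ
  · -- no ray with `⟨ρ, a⟩ < ⟨ρ, b⟩`: `b` is a common minimiser
    have h' : ∀ ρ ∈ σ, pair ρ b ≤ pair ρ a := fun ρ hρ => by
      have := not_lt.1 (fun hlt => h ⟨ρ, hρ, hlt⟩); rw [hlin] at this; linarith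
    refine ⟨b, by simp, fun ρ hρ m' hm' => ?_⟩
    simp only [Finset.mem_insert, Finset.mem_singleton] at hm'
    rcases hm' with rfl | rfl
    · exact h' ρ hρ
    · exact le_rfl

/-- **BINOMIAL TABLES ARE WINNABLE from every position with cones of at most three rays** (any `n`): the E1-legal local fan game of
`…NatResidueHypDefsND` on `V = {a, b}` — the monomial ideal `(xᵃ, xᵇ)` — reaches a `Won` position. [OURS · L1 W4.5b · row iso-w4, brick 1] -/
theorem reach_won_pair_of_card_le (a b : Fin n → ℕ) {F : Finset (Finset (Ray n))} (hF : ∀ σ ∈ F, σ.card ≤ 3) :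
    ∃ F', Reach ({a, b} : Finset (Fin n → ℕ)) F F' ∧ Won ({a, b} : Finset (Fin n → ℕ)) F' := by
  obtain ⟨F', hR, -, hW⟩ := reach_signConstant ({a, b} : Finset (Fin n → ℕ)) (fun i => (a i : ℤ) - b i)
    (fun τ hτ => bad_pair_of_crossing a b hτ) F hF
  exact ⟨F', hR, fun σ hσ => not_bad_pair_of_not_crossing a b (hW σ hσ)⟩

/-- **BINOMIAL TABLES ARE WINNABLE, `n ≤ 3`**: from every position reachable from `orthantFan n` on the table `{a, b}` some E1-legal
continuation wins (the `FanGameLocal`-shape statement for two-element tables). [OURS · L1 W4.5b · row iso-w4, brick 1] -/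
theorem reach_won_pair (hn : n ≤ 3) (a b : Fin n → ℕ) {F : Finset (Finset (Ray n))}
    (hF : Reach ({a, b} : Finset (Fin n → ℕ)) (orthantFan n) F) :
    ∃ F', Reach ({a, b} : Finset (Fin n → ℕ)) F F' ∧ Won ({a, b} : Finset (Fin n → ℕ)) F' :=
  reach_won_pair_of_card_le a b (card_le_three_of_reach_orthant hn _ hF)

/-- **The fan game of a two-element table is winnable from the orthant, `n ≤ 3`.** [OURS · L1 W4.5b · row iso-w4, brick 1] -/
theorem fanGameWinnable_pair (hn : n ≤ 3) (a b : Fin n → ℕ) :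
    ∃ F', Reach ({a, b} : Finset (Fin n → ℕ)) (orthantFan n) F' ∧ Won ({a, b} : Finset (Fin n → ℕ)) F' :=
  reach_won_pair hn a b (Reach.refl _)

/-! ### Why point stars are forced: Goward's pairwise codimension-2 schedule is not E1-legal

The table `V = {(0,2,5), (2,0,5), (0,0,9)}` (the ideal `(y²z⁵, x²z⁵, z⁹)`, non-principal exactly at the origin): NO 2-face of the orthant is
`Bad` — the only E1-legal first move is the star at the full 3-cone (the point blow-up) — although the generators are pairwise incomparable,
so that Goward's schedule [Goward 2005] would blow up a coordinate axis.  Kernel-decided. -/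

/-- The 2-face `{e₀, e₁}` (the `z`-axis) is not `Bad` for `{(0,2,5),(2,0,5),(0,0,9)}`. [OURS · kernel-decided witness] -/
theorem goward_witness_not_bad_01 :
    ¬ Bad ({![0, 2, 5], ![2, 0, 5], ![0, 0, 9]} : Finset (Fin 3 → ℕ)) ({e 3 0, e 3 1} : Finset (Ray 3)) := by
  unfold Bad; decide

/-- The 2-face `{e₀, e₂}` (the `y`-axis) is not `Bad` for `{(0,2,5),(2,0,5),(0,0,9)}`. [OURS · kernel-decided witness] -/
theorem goward_witness_not_bad_02 :
    ¬ Bad ({![0, 2, 5], ![2, 0, 5], ![0, 0, 9]} : Finset (Fin 3 → ℕ)) ({e 3 0, e 3 2} : Finset (Ray 3)) := by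
  unfold Bad; decide

/-- The 2-face `{e₁, e₂}` (the `x`-axis) is not `Bad` for `{(0,2,5),(2,0,5),(0,0,9)}`. [OURS · kernel-decided witness] -/
theorem goward_witness_not_bad_12 :
    ¬ Bad ({![0, 2, 5], ![2, 0, 5], ![0, 0, 9]} : Finset (Fin 3 → ℕ)) ({e 3 1, e 3 2} : Finset (Ray 3)) := by
  unfold Bad; decide

/-- The full 3-cone (the point) IS `Bad` for `{(0,2,5),(2,0,5),(0,0,9)}`: the only E1-legal first move. [OURS · kernel-decided witness] -/
theorem goward_witness_bad_012 :
    Bad ({![0, 2, 5], ![2, 0, 5], ![0, 0, 9]} : Finset (Fin 3 → ℕ)) ({e 3 0, e 3 1, e 3 2} : Finset (Ray 3)) := by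
  unfold Bad; decide

end FanGame

end Summit.ResolutionOfSingularities.ResolutionOfSingularities.Cruxes.EquisingularLiftNat.Sections
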